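import Summits.SmoothPoincare4.SmoothPoincare4.Theses.SymplecticOrigami
import Literature.AlgebraicTopology.SingularHomology.CechDualityCompact
import Literature.AlgebraicTopology.SingularHomology.CechTautness
import Literature.AlgebraicTopology.SingularHomology.ExcisionTheorem
import Literature.AlgebraicTopology.SingularHomology.HomologyRingChange
import Literature.AlgebraicTopology.SingularHomology.IntegralLattice
import Literature.AlgebraicTopology.SingularHomology.PoincareDualityProofs
import Literature.AlgebraicTopology.SingularHomology.CompactManifoldFiniteness
import Literature.AlgebraicTopology.SingularHomology.OrientationProofs
import Literature.AlgebraicTopology.SingularHomology.FundamentalClassExistence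
import Literature.AlgebraicTopology.SingularHomology.FundamentalClassProofs
import Literature.AlgebraicTopology.SingularHomology.UniversalCoefficientsField
import Literature.AlgebraicTopology.Homotopy.ENRTheorem
import Literature.Geometry.Manifold.TopologicalEmbedding

/-!
# Stub `stub_pinch_surfaceNbhdPair` of line `pair-rigidity-endgame` (crux `SymplecticOrigami.OrigamiRung`)

**The exact sequence of the pair `(D, D ∖ B)` for an open neighbourhood `D` of the exceptional
surface.**  `N` is a closed `ℤ`-oriented `4`-manifold, `S` a compact connected `ℤ`-oriented
surface, `b : S → N` a smooth embedding with image `B`, `D ⊇ B` open in `N`.  Then (i) for every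
field `F`, `H₁(D ∖ B; F) → H₁(D; F)` is onto with kernel of dimension `≤ 1`; (ii) if the rational
kernel is non-zero, `b_* c` is carried by `D ∖ B` for every `c ∈ H₂(S; ℤ)` (A. Hatcher,
*Algebraic Topology* (2002), Thm. 2.16, Thm. 2.20, §3.3 and Cor. 3A.6 (a); H. Miller, *Lectures
on Algebraic Topology* (2020), Thm. 37.1).  Proof, over the tree's PROVED library:

* excision `H_q(D, D ∖ B; R) ≅ H_q(N, N ∖ B; R)`
  (`relativeSingularHomology.isIso_map_of_interior_union_interior_holds`) and duality
  `H_q(N, N ∖ B; R) ≅ Ȟᵖ(B; R) ≅ Hᵖ(↥B; R) ≅ Hᵖ(S; R)`, `p + q = 4`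
  (`CechDuality.classAlong_of_isCompact` for `μ ⊗ R`, tautness `Cech.RetractionNhds.cechEquiv`
  of the compact locally contractible `B` in the Euclidean neighbourhood retract `N`), for every
  ring `R` (`PinchNbhd.nonempty_relEquiv`); the subspace `D ∖ B` of `N` is the subspace
  `D ↓∩ (N ∖ B)` of `D` up to a tautological homeomorphism;
* over a field: `H³(S; F) ≅ H₃(S; F)* = 0`, `H²(S; F) ≅ H₂(S; F)* ≅ F`, so in
  `H₂(D, D ∖ B) →∂ H₁(D ∖ B) → H₁(D) → H₁(D, D ∖ B) = 0` the middle map is onto with kernel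
  `im ∂` of dimension `≤ 1`;
* over `ℤ`: `H₂(D, D ∖ B; ℤ) ≅ H²(S; ℤ) ≅ H₀(S; ℤ) ≅ ℤ` (`poincare_duality` on `S`), and `∂` is
  injective on it once the rational kernel is non-zero (`PinchNbhd.injective_of_rational_kernel`):
  the change of coefficients `ℤ → ℚ` (`singularHomology.coeffChange`, natural in the space) has
  torsion kernel and every rational class is a rational multiple of an integral one
  (denominators clear on chains, `exists_baseChangeChain_eq_smul`), so a non-zero rational class
  in the kernel gives an integral class `y` of infinite order with a multiple in
  `ker (H₁(D ∖ B) → H₁(D)) = im ∂`, incompatible with `ker ∂ ≠ 0` inside `ℤ`; hence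
  `H₂(D) → H₂(D, D ∖ B)` vanishes, `H₂(D ∖ B; ℤ) → H₂(D; ℤ)` is onto, and `b` factors through `D`.

Everything is proved; all folklore.
-/

noncomputable section

-- the prescribed namespace `Summit.<P>.<Sub>.…` duplicates `SmoothPoincare4` (P = Sub)
set_option linter.dupNamespace false

open scoped Manifold ContDiff Topology ContinuousMap
open Set TopologicalSpace

namespace Summit.SmoothPoincare4.SmoothPoincare4.Theorems.OrigamiRung.PairRigidityEndgame

open CategoryTheory CategoryTheory.Limits
open Literature.AlgebraicTopology.SingularHomology Literature.AlgebraicTopology.Homotopy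

/-- Model space `ℝⁿ`. -/
local notation "𝔼" n:arg => EuclideanSpace ℝ (Fin n)

namespace PinchNbhd

/-! ### The algebra of step (ii): an injectivity criterion for `∂` -/

section Algebra

/-- **Injectivity of `∂` from a non-zero rational kernel.**  Let `δ : P → A₁`, `i : A₁ → X₁` be
additive with `ker i ⊆ im δ` and `P ↪ ℤ`, `i' : A₁' → X₁'` `ℚ`-linear, and `c_A`, `c_X` additive
with `c_X ∘ i = i' ∘ c_A`, `ker c_X` torsion and `A₁' = ℚ · im c_A`.  If `ker i' ≠ 0` then `δ` is
injective: a non-zero `x ∈ ker i'` has `q • x = c_A y`, `i y` is torsion, so `k • y ∈ im δ` with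
`y` of infinite order, and a non-zero element of `ker δ ⊆ P ↪ ℤ` would kill `k • y`. [folklore] -/
theorem injective_of_rational_kernel {P A₁ X₁ A₁' X₁' : Type*} [AddCommGroup P]
    [AddCommGroup A₁] [AddCommGroup X₁] [AddCommGroup A₁'] [Module ℚ A₁'] [AddCommGroup X₁']
    [Module ℚ X₁'] (δ : P →+ A₁) (i : A₁ →+ X₁) (i' : A₁' →ₗ[ℚ] X₁') (cA : A₁ →+ A₁')
    (cX : X₁ →+ X₁') (e : P →+ ℤ) (he : Function.Injective e)
    (hexact : ∀ a, i a = 0 → ∃ p, δ p = a) (hnat : ∀ a, cX (i a) = i' (cA a))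
    (hker : ∀ w, cX w = 0 → IsOfFinAddOrder w)
    (hspan : ∀ x, ∃ q : ℚ, q ≠ 0 ∧ ∃ y, cA y = q • x)
    (hx : ∃ x, i' x = 0 ∧ x ≠ 0) : Function.Injective δ := by
  obtain ⟨x, hix, hx0⟩ := hx
  obtain ⟨q, hq, y, hy⟩ := hspan x
  -- `i y` dies rationally, hence is torsion: `k • i y = 0`
  have h1 : cX (i y) = 0 := by rw [hnat, hy, map_smul, hix, smul_zero]
  obtain ⟨k, hk, hky⟩ := (isOfFinAddOrder_iff_zsmul_eq_zero).mp (hker _ h1)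
  obtain ⟨p, hp⟩ := hexact (k • y) (by rw [map_zsmul, hky])
  -- no non-zero integer kills `y`: `c_A (m • y) = (m q) • x`
  have hfree : ∀ m : ℤ, m • y = 0 → m = 0 := by
    intro m hm
    have h : ((m : ℚ) * q) • x = 0 := by
      rw [mul_smul, ← hy, Int.cast_smul_eq_zsmul ℚ m, ← map_zsmul cA, hm, map_zero]
    rcases smul_eq_zero.mp h with h | h
    · exact_mod_cast (mul_eq_zero.mp h).resolve_right hq
    · exact absurd h hx0
  rw [injective_iff_map_eq_zero]
  intro r hr
  -- `e r • p = e p • r` in `P ↪ ℤ`, so `(e r * k) • y = e p • δ r = 0`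
  have hcomm : e r • p = e p • r :=
    he (by rw [map_zsmul, map_zsmul, smul_eq_mul, smul_eq_mul, mul_comm])
  have h0 : (e r * k) • y = 0 := by
    rw [mul_zsmul, ← hp, ← map_zsmul δ, hcomm, map_zsmul, hr, smul_zero]
  have her : e r = 0 := (mul_eq_zero.mp (hfree _ h0)).resolve_right hk
  exact he (by rw [her, map_zero])

end Algebra

/-! ### Change of coefficients `ℤ → ℚ` on homology: torsion kernel, full rational span -/

section CoeffChange

open singularChainComplex

variable {Y : Type} [TopologicalSpace Y]

/-- **The kernel of `H_n(Y; ℤ) → H_n(Y; ℚ)` is torsion** (Hatcher 2002, Cor. 3A.6 (a)): if an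
integral cycle `z` bounds a rational chain `b`, clear the denominators of `b`
(`exists_baseChangeChain_eq_smul`) to get `d • z = ∂b'` integrally (`baseChangeChain_injective`).
[folklore] -/
theorem isOfFinAddOrder_of_coeffChange_eq_zero (n : ℕ) (y : singularHomology ℤ ℤ Y n)
    (hy : singularHomology.coeffChange Y (Int.castAddHom ℚ) n y = 0) : IsOfFinAddOrder y := by
  induction y using singularHomology_induction_on with
  | h z =>
    rw [singularHomology.coeffChange_homologyπ] at hy
    obtain ⟨b, hb⟩ := exists_d_eq_iCycles_of_homologyπ_eq_zero' _ hy
    rw [iCycles_cyclesCoeffChange] at hb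
    obtain ⟨d, hd, b', hb'⟩ := exists_baseChangeChain_eq_smul ℤ ℚ (n + 1) b
    have key : (singularChainComplex ℤ ℤ Y).d (n + 1) n b' = d • iCycles ℤ ℤ Y n z := by
      apply baseChangeChain_injective ℤ ℚ n
      rw [← d_baseChangeChain, hb', map_smul, hb, map_zsmul, ← Int.cast_smul_eq_zsmul ℚ d]
      rfl
    rw [isOfFinAddOrder_iff_zsmul_eq_zero]
    refine ⟨d, hd, ?_⟩
    have hz : d • z = toCycles ℤ ℤ Y (n + 1) n b' :=
      cycles_ext (by rw [map_zsmul, iCycles_toCycles, key])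
    rw [← map_zsmul, hz, homologyπ_toCycles]

/-- **Every rational class is a non-zero rational multiple of an integral class** (Hatcher 2002,
Cor. 3A.6 (a)): clear the denominators of a representing rational cycle; the integral chain
obtained is a cycle, the change of coefficients being injective on chains and compatible with
`∂`. [folklore] -/
theorem exists_coeffChange_eq_smul (n : ℕ) (x : singularHomology ℚ ℚ Y n) :
    ∃ q : ℚ, q ≠ 0 ∧ ∃ y : singularHomology ℤ ℤ Y n,
      singularHomology.coeffChange Y (Int.castAddHom ℚ) n y = q • x := by
  induction x using singularHomology_induction_on with
  | h w =>
    obtain ⟨d, hd, c, hc⟩ := exists_baseChangeChain_eq_smul ℤ ℚ n (iCycles ℚ ℚ Y n w)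
    have hdc : (singularChainComplex ℤ ℤ Y).d n ((ComplexShape.down ℕ).next n) c = 0 := by
      cases n with
      | zero =>
        rw [(singularChainComplex ℤ ℤ Y).shape 0 _ (by simp)]
        rfl
      | succ m =>
        rw [ChainComplex.next_nat_succ]
        apply baseChangeChain_injective ℤ ℚ m
        rw [← d_baseChangeChain, hc, map_smul, d_iCycles, smul_zero, map_zero]
    obtain ⟨z, hz⟩ := exists_cycles_of_d_eq_zero rfl c hdc
    refine ⟨d, by exact_mod_cast hd, (singularChainComplex ℤ ℤ Y).homologyπ n z, ?_⟩
    rw [singularHomology.coeffChange_homologyπ, ← map_smul]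
    congr 1
    refine cycles_ext ?_
    rw [iCycles_cyclesCoeffChange, map_smul, hz]
    exact hc

end CoeffChange

/-! ### Steps in the exact sequence of a pair; subspaces -/

section Pair

variable {X : Type} [TopologicalSpace X] (A : Set X)

/-- In `H₂(X, A) →∂ H₁(A) →i H₁(X) → H₁(X, A)` (Hatcher Thm. 2.16), over a field: if
`H₁(X, A) = 0` and `dim H₂(X, A) ≤ 1` then `i` is onto with `dim ker i = dim im ∂ ≤ 1`; both
statements are unchanged by precomposing `i` with an isomorphism `e`. [folklore] -/
theorem pair_one (F : Type) [Field F] (h1 : IsZero (relativeSingularHomology F F X A 1))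
    [Module.Finite F (relativeSingularHomology F F X A 2)]
    (h2 : Module.finrank F (relativeSingularHomology F F X A 2) ≤ 1) {U : ModuleCat.{0} F}
    (e : U ≅ singularHomology F F ↥A 1) :
    Function.Surjective (e.hom ≫ singularHomology.map F F (subsetIncl A) 1) ∧
      Module.finrank F
        (LinearMap.ker (e.hom ≫ singularHomology.map F F (subsetIncl A) 1).hom) ≤ 1 := by
  constructor
  · have hepi := (relativeSingularHomology.exact_map_ofAbsolute F F A 1).epi_f (h1.eq_of_tgt _ _)
    change Function.Surjective ((singularHomology.map F F (subsetIncl A) 1).hom.comp e.hom.hom)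
    exact ((ModuleCat.epi_iff_surjective _).mp hepi).comp e.toLinearEquiv.surjective
  · rw [ModuleCat.hom_comp, LinearMap.ker_comp]
    refine (e.toLinearEquiv.ofSubmodule' _).finrank_eq.trans_le ?_
    rw [← (relativeSingularHomology.exact_δ_map F F A 1).moduleCat_range_eq_ker]
    exact (LinearMap.finrank_range_le _).trans h2

/-- In `H₂(A) →i H₂(X) →j H₂(X, A) →∂ H₁(A)` (Hatcher Thm. 2.16): if `∂` is injective then
`j = 0` and `i` is onto. [folklore] -/
theorem surjective_map_two_of_injective_δ {R : Type} [CommRing R]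
    (hδ : Function.Injective (relativeSingularHomology.δ R R X A 1)) :
    Function.Surjective (singularHomology.map R R (subsetIncl A) 2) := by
  haveI : Mono (relativeSingularHomology.δ R R X A 1) := (ModuleCat.mono_iff_injective _).mpr hδ
  have hj : relativeSingularHomology.ofAbsolute R R X A 2 = 0 :=
    zero_of_comp_mono (relativeSingularHomology.δ R R X A 1)
      (relativeSingularHomology.ofAbsolute_comp_δ R R A 1)
  exact (ModuleCat.epi_iff_surjective _).mp
    ((relativeSingularHomology.exact_map_ofAbsolute R R A 2).epi_f hj)

/-- The tautological homeomorphism `e : ↥(D ∖ B) ≃ₜ {x : ↥D // ↑x ∉ B}` over `D` and over `X`.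
[folklore] -/
theorem exists_diffHomeomorph (D B : Set X) :
    ∃ e : ↥(D \ B) ≃ₜ ↥(Subtype.val ⁻¹' Bᶜ : Set ↥D),
      (⟨Set.inclusion Set.sdiff_subset, continuous_inclusion Set.sdiff_subset⟩ :
          C(↥(D \ B), ↥D)) = (subsetIncl (Subtype.val ⁻¹' Bᶜ : Set ↥D)).comp (e : C(_, _)) ∧
        (⟨Subtype.val, continuous_subtype_val⟩ : C(↥(D \ B), X)) =
          (subsetIncl D).comp ((subsetIncl (Subtype.val ⁻¹' Bᶜ : Set ↥D)).comp (e : C(_, _))) :=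
  ⟨{ toFun := fun x => ⟨⟨x.1, x.2.1⟩, x.2.2⟩
     invFun := fun x => ⟨x.1.1, x.1.2, x.2⟩
     left_inv := fun _ => rfl
     right_inv := fun _ => rfl
     continuous_toFun := by fun_prop
     continuous_invFun := by fun_prop }, rfl, rfl⟩

end Pair

/-! ### Excision to `N` and Čech–Alexander–Poincaré duality along `B` -/

section Duality

variable {N : Type} [TopologicalSpace N] [T2Space N] [ChartedSpace (𝔼 4) N] {S : Type}
  [TopologicalSpace S] {b : S → N}

/-- **`H_q(D, D ↓∩ (N ∖ B); R) ≅ H_q(N, N ∖ B; R) ≅ Ȟᵖ(B; R) ≅ Hᵖ(↥B; R) ≅ Hᵖ(S; R)`** for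
`D ⊇ B` open and `p + q = 4`: excision (Hatcher Thm. 2.20, the interiors of `N ∖ B` and `D`
cover `N`; `relativeSingularHomology.isIso_map_of_interior_union_interior_holds`), Miller
Thm. 37.1 (`CechDuality.classAlong_of_isCompact` for the `R`-orientation `μ ⊗ R`), tautness
(`Cech.RetractionNhds.cechEquiv`) and `B ≅ S`. [folklore] -/
theorem nonempty_relEquiv (R : Type) [CommRing R] (hbe : Topology.IsEmbedding b)
    (hBc : IsCompact (Set.range b)) (T : Cech.RetractionNhds (Set.range b))
    (μ : HomologicalOrientation ℤ N 4) {D : Set N} (hD : IsOpen D) (hBD : Set.range b ⊆ D)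
    {p q : ℕ} (h : p + q = 4) :
    Nonempty (relativeSingularHomology R R ↥D (Subtype.val ⁻¹' (Set.range b)ᶜ) q ≃ₗ[R]
      singularCohomology R R S p) := by
  haveI := relativeSingularHomology.isIso_map_of_interior_union_interior_holds R R N
    (Set.range b)ᶜ D (by
      rw [hBc.isClosed.isOpen_compl.interior_eq, hD.interior_eq]
      exact Set.eq_univ_of_forall fun x => (em (x ∈ Set.range b)).elim
        (fun h => Or.inr (hBD h)) Or.inl) q
  exact ⟨(asIso (relativeSingularHomology.map R R (subsetIncl D)
      (Set.mapsTo_preimage Subtype.val (Set.range b)ᶜ) q)).toLinearEquiv ≪≫ₗ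
    (relativeSingularHomology.concreteIso R R N (Set.range b)ᶜ q).toLinearEquiv ≪≫ₗ
    (LinearEquiv.ofBijective _
      (CechDuality.classAlong_of_isCompact (by norm_num) (μ.toCoeff R) hBc p q h)).symm ≪≫ₗ
    T.cechEquiv R p ≪≫ₗ (singularCohomology.mapIso R R hbe.toHomeomorph p).toLinearEquiv⟩

end Duality

end PinchNbhd

open PinchNbhd in
/-- **Stub — the pair `(D, D ∖ B)` of an open neighbourhood of the exceptional surface.**  Let
`N` be a closed `ℤ`-oriented 4-manifold, `S` a compact connected `ℤ`-oriented surface,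
`b : S → N` a smooth embedding with image `B`, `D ⊇ B` open.  (i) For every field `F`,
`H₁(D ∖ B; F) → H₁(D; F)` is onto with kernel of dimension `≤ 1`: by excision
`H_k(D, D ∖ B) ≅ H_k(N, N ∖ B)` (Hatcher Thm. 2.20) and Čech–Alexander–Poincaré duality
`H_k(N, N ∖ B; F) ≅ H^{4-k}(S; F)` (Miller Thm. 37.1, Hatcher Prop. 3.46) the next term
`H₁(D, D ∖ B; F) ≅ H³(S; F)` vanishes and the kernel is the image of
`H₂(D, D ∖ B; F) ≅ H²(S; F) ≅ F` (Hatcher Thm. 2.16).  (ii) If the rational kernel is non-zero,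
`∂ : H₂(D, D ∖ B; ℤ) ≅ ℤ → H₁(D ∖ B; ℤ)` is injective (change of coefficients `ℤ → ℚ`,
Hatcher Cor. 3A.6 (a): torsion kernel, rational classes have integral multiples), so
`H₂(D ∖ B; ℤ) → H₂(D; ℤ)` is onto and `b_* c`, which factors through `D ⊇ B`, is carried by
`D ∖ B`. [folklore] -/
theorem stub_pinch_surfaceNbhdPair :
    ∀ (N : Type) [TopologicalSpace N] [T2Space N] [SecondCountableTopology N] [CompactSpace N]
      [ConnectedSpace N] [ChartedSpace (𝔼 4) N] [IsManifold (𝓡 4) ∞ N]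
      (S : Type) [TopologicalSpace S] [CompactSpace S] [ConnectedSpace S] [ChartedSpace (𝔼 2) S]
      [IsManifold (𝓡 2) ∞ S] (b : S → N) (hb : Manifold.IsSmoothEmbedding (𝓡 2) (𝓡 4) ∞ b)
      (D : Set N), IsOpen D → Set.range b ⊆ D →
      Nonempty (HomologicalOrientation ℤ N 4) → Nonempty (HomologicalOrientation ℤ S 2) →
      (∀ (F : Type) [Field F],
        Function.Surjective (singularHomology.map F F
          (⟨Set.inclusion Set.sdiff_subset, continuous_inclusion Set.sdiff_subset⟩ :
            C(↥(D \ Set.range b), ↥D)) 1) ∧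
        Module.finrank F (LinearMap.ker (singularHomology.map F F
          (⟨Set.inclusion Set.sdiff_subset, continuous_inclusion Set.sdiff_subset⟩ :
            C(↥(D \ Set.range b), ↥D)) 1).hom) ≤ 1) ∧
      (LinearMap.ker (singularHomology.map ℚ ℚ
          (⟨Set.inclusion Set.sdiff_subset, continuous_inclusion Set.sdiff_subset⟩ :
            C(↥(D \ Set.range b), ↥D)) 1).hom ≠ ⊥ →
        ∀ c : singularHomology ℤ ℤ S 2,
          ∃ d : singularHomology ℤ ℤ ↥(D \ Set.range b) 2,
            singularHomology.map ℤ ℤ (⟨Subtype.val, continuous_subtype_val⟩ :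
                C(↥(D \ Set.range b), N)) 2 d =
              singularHomology.map ℤ ℤ ⟨b, hb.isEmbedding.continuous⟩ 2 c) := by
  intro N _ _ _ _ _ _ _ S _ _ _ _ _ b hb D hD hBD hμ hμS
  obtain ⟨μ⟩ := hμ
  obtain ⟨μS⟩ := hμS
  -- ### the compact set `B = b(S)`, homeomorphic to `S`, taut in `N`
  have hbe : Topology.IsEmbedding b := hb.isEmbedding
  haveI : T2Space S := hbe.t2Space
  have hBc : IsCompact (Set.range b) := isCompact_range hbe.continuous
  obtain ⟨m, ι, hιc⟩ :=
    Literature.Geometry.Manifold.exists_isClosedEmbedding_pi_of_compactSpace (𝔼 4) (M := N)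
  have hNR : IsNeighbourhoodRetract (Set.range ι) :=
    isNeighbourhoodRetract_range_of_compactSpace
      isNeighbourhoodRetract_of_locallyContractibleSpace_holds (𝔼 4) hιc.isEmbedding
  have hKl : LocallyContractibleSpace ↥(Set.range b) :=
    locallyContractibleSpace_of_homeomorph hbe.toHomeomorph
      (locallyContractibleSpace_of_chartedSpace (𝔼 2))
  obtain ⟨T⟩ := Cech.RetractionNhds.nonempty_of_locallyContractibleSpace (K := Set.range b)
    hιc.isEmbedding hNR hBc hKl
  -- ### the pair `(D, A)`, `A = D ↓∩ (N ∖ B) ≅ D ∖ B`; `b` factors through `D`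
  set A : Set ↥D := Subtype.val ⁻¹' (Set.range b)ᶜ
  obtain ⟨e, he, heN⟩ := exists_diffHomeomorph D (Set.range b)
  let bD : C(S, ↥D) := ⟨fun s => ⟨b s, hBD ⟨s, rfl⟩⟩, hbe.continuous.subtype_mk _⟩
  have hbD : (⟨b, hb.isEmbedding.continuous⟩ : C(S, N)) = (subsetIncl D).comp bD := rfl
  -- ### the homology of the surface
  haveI := ChartedSpace.locallyPathConnectedSpace (𝔼 2) S
  haveI : PathConnectedSpace S := pathConnectedSpace_iff_connectedSpace.mpr inferInstance
  refine ⟨fun F _ => ?_, fun hK c => ?_⟩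
  · -- ### (i) field coefficients: `H_q(D, A; F) ≅ Hᵖ(S; F) ≅ H_p(S; F)*`
    haveI := singularHomology.isIso_ε_of_pathConnectedSpace F F (X := S)
    have E' : ∀ {p q : ℕ}, p + q = 4 →
        Nonempty (relativeSingularHomology F F ↥D A q ≃ₗ[F]
          Module.Dual F (singularHomology F F S p)) := fun {p q} h => by
      obtain ⟨E⟩ := nonempty_relEquiv F hbe hBc T μ hD hBD h
      exact ⟨E ≪≫ₗ LinearEquiv.ofBijective _ (kroneckerPairing_bijective_of_field F S p)⟩
    -- `H₁(D, A; F) ≅ H₃(S; F)* = 0`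
    have h1 : IsZero (relativeSingularHomology F F ↥D A 1) := by
      obtain ⟨E₁⟩ := E' (p := 3) (q := 1) (by norm_num)
      haveI := ModuleCat.subsingleton_of_isZero
        (isZero_singularHomology_of_lt_holds F F S 2 (show 2 < 3 by norm_num))
      haveI : Subsingleton (relativeSingularHomology F F ↥D A 1) := E₁.toEquiv.subsingleton
      exact ModuleCat.isZero_of_subsingleton _
    -- `H₂(D, A; F) ≅ H₂(S; F)* ≅ F`
    obtain ⟨E₂⟩ := E' (p := 2) (q := 2) (by norm_num)
    haveI : Module.Finite F (singularHomology F F S 2) :=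
      finite_singularHomology_of_compactSpace_holds F S 2 2
    haveI : Module.Finite F (relativeSingularHomology F F ↥D A 2) := Module.Finite.equiv E₂.symm
    have h2 : Module.finrank F (relativeSingularHomology F F ↥D A 2) ≤ 1 := by
      obtain ⟨e₂⟩ := nonempty_singularHomology_top_iso_holds (R := F) (X := S) 2 (μS.toCoeff F)
      rw [E₂.finrank_eq, Subspace.dual_finrank_eq,
        (e₂.toLinearEquiv.trans ULift.moduleEquiv).finrank_eq, Module.finrank_self]
    rw [he, singularHomology.map_comp]
    exact pair_one A F h1 h2 (singularHomology.mapIso F F e 1)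
  · -- ### (ii) integral coefficients: a non-zero rational class of `H₁(A; ℚ)` dying in `H₁(D)`
    have hx : ∃ x, (singularHomology.map ℚ ℚ (subsetIncl A) 1).hom x = 0 ∧ x ≠ 0 := by
      obtain ⟨x', hx', hx'0⟩ := (Submodule.ne_bot_iff _).mp hK
      rw [he, singularHomology.map_comp, LinearMap.mem_ker, ModuleCat.hom_comp,
        LinearMap.comp_apply] at hx'
      exact ⟨_, hx', fun h0 => hx'0 ((singularHomology.mapIso ℚ ℚ e 1).toLinearEquiv.injective
        (h0.trans (map_zero _).symm))⟩
    -- `H₂(D, A; ℤ) ≅ H²(S; ℤ) ≅ H₀(S; ℤ) ≅ ℤ`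
    haveI := singularHomology.isIso_ε_of_pathConnectedSpace ℤ ℤ (X := S)
    obtain ⟨E⟩ := nonempty_relEquiv ℤ hbe hBc T μ hD hBD (show 2 + 2 = 4 by norm_num)
    have eZ : relativeSingularHomology ℤ ℤ ↥D A 2 ≃ₗ[ℤ] ℤ :=
      E ≪≫ₗ LinearEquiv.ofBijective (poincareDualityMap μS (show 2 + 0 = 2 by norm_num))
          (poincare_duality μS _) ≪≫ₗ
        (asIso (singularHomology.ε ℤ ℤ S)).toLinearEquiv ≪≫ₗ ULift.moduleEquiv
    -- `∂ : H₂(D, A; ℤ) → H₁(A; ℤ)` is injective, so `H₂(A; ℤ) → H₂(D; ℤ)` is onto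
    have hδ : Function.Injective (relativeSingularHomology.δ ℤ ℤ ↥D A 1) :=
      injective_of_rational_kernel (relativeSingularHomology.δ ℤ ℤ ↥D A 1).hom.toAddMonoidHom
        (singularHomology.map ℤ ℤ (subsetIncl A) 1).hom.toAddMonoidHom
        (singularHomology.map ℚ ℚ (subsetIncl A) 1).hom
        (singularHomology.coeffChange ↥A (Int.castAddHom ℚ) 1)
        (singularHomology.coeffChange ↥D (Int.castAddHom ℚ) 1)
        eZ.toLinearMap.toAddMonoidHom eZ.injective
        ((ShortComplex.moduleCat_exact_iff _).mp (relativeSingularHomology.exact_δ_map ℤ ℤ A 1))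
        (fun a => singularHomology.coeffChange_map (Int.castAddHom ℚ) (subsetIncl A) a)
        (isOfFinAddOrder_of_coeffChange_eq_zero 1) (exists_coeffChange_eq_smul 1) hx
    obtain ⟨d', hd'⟩ := surjective_map_two_of_injective_δ A hδ (singularHomology.map ℤ ℤ bD 2 c)
    refine ⟨(singularHomology.mapIso ℤ ℤ e 2).inv d', ?_⟩
    rw [heN, singularHomology.map_comp, singularHomology.map_comp, hbD,
      singularHomology.map_comp, ModuleCat.comp_apply, ModuleCat.comp_apply,
      ModuleCat.comp_apply, ← hd']
    congr 1
    change (singularHomology.map ℤ ℤ (subsetIncl A) 2)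
      (((singularHomology.mapIso ℤ ℤ e 2).inv ≫ (singularHomology.mapIso ℤ ℤ e 2).hom) d') = _
    rw [(singularHomology.mapIso ℤ ℤ e 2).inv_hom_id]
    rfl

end Summit.SmoothPoincare4.SmoothPoincare4.Theorems.OrigamiRung.PairRigidityEndgame

end
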